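import Summits.Ventures.PercRepro.OrbitK

/-!
# PercRepro — C-025 «RANK LEVEL-SET INEQUALITY»: the matroid layer of ORBIT-k (typer-2, gen 5)

`conjectures/CONJECTURES.md` row C-025 (lead 11:00:00Z, v58; mine-2 M2-10 parts 2–4: affine bound → orbit
reduction → matroid form; typing asked 11:00:10Z): for every finite matroid `(E, ρ)` and integers
`p > q ≥ 0` with `p − q ≥ 2`,

  `#{A ⊆ E : q < ρ(A) < p} ≥ Φ(p, q) · #{A ⊆ E : ρ(A) = p, ρ(E ∖ A) = q}`,  `Φ(p, q) = Σ_{q<u<p} C(p+q, u) / C(p+q, p)`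

(`Φ = phiK` of `OrbitK.lean`). Mine-2 part 4: the cases `q = 0` and `(p, q) = (3, 1)` are PROVED, equality iff
`U_{4,4}` / `U_{3,4} ⊕ loops` (C-022 (Q13)'s locus); the free matroid on `p + q` elements attains equality in
every pair. On a multigraph with all `k` vertices marked, `N(X) = k − ρ(X)` for the cycle matroid, so with
`p = k − i`, `q = k − j` the matroid statement on the top orbit `(⊥, ⊤)` is `Σ_{i<l<j} c_l ≥ Φ(k − i, k − j)·a_ij`
(mine-2 part 2, the AFFINE BOUND), and every orbit `(I, D)` follows from the minor `M/I‖D` via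
`Φ(p + ρ(I), q + ρ(I)) ≤ Φ(p, q)`. The marked-among-unmarked rows C-021 / C-022 and the `κ` constants of
C-023 are NOT instances (the mark-merge count is not submodular).

* **`C025`** — the row of record, on Mathlib's `Matroid α` with `[M.Finite]` (finite ground set `M.E`),
  `ρ = M.eRk : Set α → ℕ∞`, subsets of `E` counted by `Set.ncard`;
* `phiK_two_zero`, `phiK_three_one` — the constants of the two proved cases (`2`, `3/2`);
* `MultiGraph.OrbitAffine`, `C025Graph` — the all-marked graph instance on every orbit in `OrbitK`'s vocabulary
  (`m` a bijection `Fin k → V`, constant `Φ(k − i, k − j)`): a SHAPE recorded for the cross-check with C-023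
  (`OrbitK` at `i + j = k + 1` has the same constant), not a row.
-/

namespace PercRepro

open Finset

/-- `Φ(2, 0) = 2` — the constant of the proved case `q = 0`, `p = 2`. -/
theorem phiK_two_zero : phiK 2 0 = 2 := by
  unfold phiK
  norm_num [ioo_zero_two]

/-- `Φ(3, 1) = 3/2` — the constant of the proved case `(p, q) = (3, 1)` (= `κ(1, 3; 4)` of C-022 (Q13)). -/
theorem phiK_three_one : phiK 3 1 = 3 / 2 := by
  unfold phiK
  norm_num [ioo_one_three, show Nat.choose 4 2 = 6 from rfl]

/-- **C-025 = RANK LEVEL-SET INEQUALITY** (mine-2 M2-10 parts 2–4; CONJECTURES v58): for every finite matroid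
`M` on a ground set `M.E` and all `p > q ≥ 0` with `p − q ≥ 2`, the number of subsets `A ⊆ E` with
`q < ρ(A) < p` is at least `Φ(p, q)` times the number of `A ⊆ E` with `ρ(A) = p` and `ρ(E ∖ A) = q`
(`ρ = M.eRk`, `ℕ∞`-valued — finite on a finite matroid; counts as `Set.ncard`, in `ℚ`). -/
def C025 : Prop :=
  ∀ {α : Type} (M : Matroid α) [M.Finite] (p q : ℕ), q + 2 ≤ p →
    phiK p q * ({A : Set α | A ⊆ M.E ∧ M.eRk A = (p : ℕ∞) ∧ M.eRk (M.E \ A) = (q : ℕ∞)}.ncard : ℚ) ≤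
      ({A : Set α | A ⊆ M.E ∧ (q : ℕ∞) < M.eRk A ∧ M.eRk A < (p : ℕ∞)}.ncard : ℚ)

namespace MultiGraph

variable {V E : Type*} (G : MultiGraph V E) [DecidableEq V] [Fintype V] [Fintype E] [DecidableEq E]

/-- **The affine bound on one interval for the pair `(i, j)`** (mine-2 part 2): `Φ(k − i, k − j) · a_ij ≤
Σ_{i<l<j} c_l` (in `ℚ`) — `OrbitK` with the constant `Φ(k − i, k − j)` in place of `κ(i, j; k)`. -/
def OrbitAffine {k : ℕ} (m : Fin k → V) (I D : Config E) (i j : ℕ) : Prop :=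
  phiK (k - i) (k - j) * (G.antipodalCount m I D i j : ℚ) ≤ ∑ l ∈ Finset.Ioo i j, (G.intervalCount m I D l : ℚ)

/-- `OrbitAffine` is decidable on finite data. -/
instance {k : ℕ} (m : Fin k → V) (I D : Config E) (i j : ℕ) : Decidable (G.OrbitAffine m I D i j) := by
  unfold OrbitAffine; infer_instance

/-- At `i + j = k + 1` the affine constant is the second-family value of `κ(i, j; k)`. -/
theorem kappaK_eq_phiK_of_succ {i j k : ℕ} (hi : 1 ≤ i) (hij : i < j) (h : i + j = k + 1) :
    kappaK i j k = phiK (k - i) (k - j) := by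
  unfold kappaK
  have h1 : ¬ i + j ≤ k := by omega
  rw [if_neg h1, if_pos h]
  congr 1 <;> omega

end MultiGraph

/-- **The all-marked graph instance of C-025 on every orbit** (a shape, not a row): every finite multigraph,
every bijective marking `m : Fin k → V` of ALL its vertices, every interval `[I, I ⊔ D]` and every pair
`1 ≤ i`, `i + 2 ≤ j ≤ k` satisfy the affine bound `Σ_{i<l<j} c_l ≥ Φ(k − i, k − j)·a_ij`. -/
def C025Graph : Prop :=
  ∀ {V E : Type} [DecidableEq V] [Fintype V] [Fintype E] [DecidableEq E] (G : MultiGraph V E)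
    (k : ℕ) (m : Fin k → V), Function.Bijective m → ∀ (I D : Config E), I ⊓ D = ⊥ →
      ∀ i j : ℕ, 1 ≤ i → i + 2 ≤ j → j ≤ k → G.OrbitAffine m I D i j

end PercRepro
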